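import Mathlib.Data.Finset.Sum
import Summits.CriticalPhenomena.PercolationContinuityZ3.Theorems.PercNearOneGluingNoHeavyLowerTailSahiCombTriWKlShell
import Summits.CriticalPhenomena.PercolationContinuityZ3.Theorems.PercNearOneGluingNoHeavyLowerTailSahiCombTriWScore

/-!
# OR-PRODUCTS: Kleitman shells — hence the Formula-A stratum of `TRI_W(a)` — are closed under `P₁ ∨ P₂` over disjoint coordinate blocks

Support file of the one-cut programme (crux `NoHeavyLowerTail`, stmt-CriticalPhenomena-4575; unit `prim-lf-1` gen 41, memo
`FROM-prim-lf-1-gen41-SHELLS-AND-OR-PRODUCTS.md`).  Continuation of `…SahiCombTriWShell` (Kleitman shells, `triW_nonneg_of_shell`).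

The cube on a disjoint union of coordinate blocks is `W = Finset (γ₁ ⊕ γ₂) ≅ Finset γ₁ × Finset γ₂` (`Finset.toLeft`, `Finset.toRight`,
`Finset.disjSum`), and complementation acts blockwise.  For families `P₁ ⊆ Finset γ₁`, `P₂ ⊆ Finset γ₂` the **OR-product** is
`orProd P₁ P₂ = {t | t.toLeft ∈ P₁ ∨ t.toRight ∈ P₂}` (e.g. `↑g ∪ ↑h` for disjoint `g, h` is `{g} ∨ {h}`-like: `{top} ∨ {top}`; `maj ∨ maj`;
a free block is `∅ ∨ P`).  Its shell is `W ∖ (Z₁ × Z₂)` with `Z_i = W_i ∖ (P_i ∪ refl P_i)`.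

* `FiveUpSet.klL_zProd_eq` — FIBRE IDENTITY: for any regions `Z₁, Z₂` and families `A, B` of `W`,
  `klL (Z₁ × Z₂) A B = Σ_{y ∈ Z₂} klL Z₁ (A^y) (B^y) + Σ_{x ∈ Z₁} klL Z₂ (A_{xᶜ}) (B_x)`
  with the sections `A^y = {x | x ⊔ y ∈ A}` (`secL`), `A_x = {y | x ⊔ y ∈ A}` (`secR`) — from `a(x,y) − a(xᶜ,yᶜ) = [a(x,y) − a(xᶜ,y)] + [a(xᶜ,y) − a(xᶜ,yᶜ)]`.
* **`FiveUpSet.klShell_prod`** — if `T₁ ⊆ Finset γ₁` and `T₂ ⊆ Finset γ₂` are Kleitman shells then so is `W ∖ (T₁ᶜ × T₂ᶜ)`: by the fibre identity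
  `klL (T₁ᶜ × T₂ᶜ) ≤ Σ_{y∈T₂ᶜ} klL univ (A^y)(B^y) + Σ_{x∈T₁ᶜ} klL univ (A_{xᶜ})(B_x) ≤ klL univ A B` (shell hypothesis fibrewise, then Kleitman on the
  dropped fibres, then the fibre identity for `univ × univ`).
* `FiveUpSet.orProd`, `isUpperSet_orProd`, `orProd_union_refl` (its shell is `W ∖ ((P₁ ∪ refl P₁)ᶜ × (P₂ ∪ refl P₂)ᶜ)`), **`klShell_orProd`**, and
  **`FiveUpSet.triW_nonneg_orProd`**: up-sets `P₁, P₂` with Kleitman shells ⟹ `0 ≤ triW (orProd P₁ P₂) F G` for every index cube and all monotone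
  families of up-sets (all `a`).  Since `orProd` of shell families is again a shell family, the construction ITERATES over any number of blocks.
Shell families available in the tree: saturated (`klShell_of_saturated`), principal `↑g` (`klShell_upGen`), `{univ}` (`klShell_pair`), `∅`, every
antipode-free `P` with `Cor_P ≥ 0` (co-covering generators, coatoms, thresholds with (AB)…).  Numerical cross-check (exact, all pairs of up-sets):
`↑g ∪ ↑gᶜ` for `n ≤ 6`, `↑01 ∪ ↑23 ∪ ↑45`-type, `maj(012) ∨ maj(345)`, `x₀ ∨ (≥3 of 4)`, `x₀x₁ ∨ maj(234)` — all certified by Formula A.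
HONEST LABEL: complete proofs, std axioms; a closure theorem producing infinitely many new unconditional strata of `TriWIneq`; `TriWIneq` itself
stays OPEN (families without a Kleitman shell, e.g. `K₂₂`, `x₀(x₁ ∨ x₂)`, are not OR-products of shell families). [this work]
-/

namespace Summit.CriticalPhenomena.PercolationContinuityZ3.Theorems

namespace FiveUpSet

open Finset

variable {β γ₁ γ₂ : Type} [DecidableEq β] [Fintype β] [DecidableEq γ₁] [Fintype γ₁] [DecidableEq γ₂] [Fintype γ₂]

/-! ### Blockwise complement and sections -/

omit [DecidableEq β] [Fintype β] in
/-- Complementation acts blockwise on the left block. [this work] -/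
theorem toLeft_compl (t : Finset (γ₁ ⊕ γ₂)) : tᶜ.toLeft = t.toLeftᶜ := by
  ext a; simp [mem_compl]

omit [DecidableEq β] [Fintype β] in
/-- Complementation acts blockwise on the right block. [this work] -/
theorem toRight_compl (t : Finset (γ₁ ⊕ γ₂)) : tᶜ.toRight = t.toRightᶜ := by
  ext a; simp [mem_compl]

omit [DecidableEq β] [Fintype β] in
/-- `(x ⊔ y)ᶜ = xᶜ ⊔ yᶜ`. [this work] -/
theorem compl_disjSum (x : Finset γ₁) (y : Finset γ₂) : (x.disjSum y)ᶜ = xᶜ.disjSum yᶜ := by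
  ext a
  rcases a with a | a <;> simp [mem_compl]

/-- Left section of a family at a right coordinate `y`: `A^y = {x | x ⊔ y ∈ A}`. [this work] -/
def secL (A : Finset (Finset (γ₁ ⊕ γ₂))) (y : Finset γ₂) : Finset (Finset γ₁) := univ.filter fun x => x.disjSum y ∈ A

/-- Right section of a family at a left coordinate `x`: `A_x = {y | x ⊔ y ∈ A}`. [this work] -/
def secR (A : Finset (Finset (γ₁ ⊕ γ₂))) (x : Finset γ₁) : Finset (Finset γ₂) := univ.filter fun y => x.disjSum y ∈ A

omit [DecidableEq β] [Fintype β] [Fintype γ₂] in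
/-- Membership in a left section. [this work] -/
@[simp] theorem mem_secL {A : Finset (Finset (γ₁ ⊕ γ₂))} {y : Finset γ₂} {x : Finset γ₁} : x ∈ secL A y ↔ x.disjSum y ∈ A := by
  simp [secL]

omit [DecidableEq β] [Fintype β] [Fintype γ₁] in
/-- Membership in a right section. [this work] -/
@[simp] theorem mem_secR {A : Finset (Finset (γ₁ ⊕ γ₂))} {x : Finset γ₁} {y : Finset γ₂} : y ∈ secR A x ↔ x.disjSum y ∈ A := by
  simp [secR]

omit [DecidableEq β] [Fintype β] [Fintype γ₂] in
/-- Sections of an up-set are up-sets (left). [this work] -/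
theorem isUpperSet_secL {A : Finset (Finset (γ₁ ⊕ γ₂))} (hA : IsUpperSet (A : Set (Finset (γ₁ ⊕ γ₂)))) (y : Finset γ₂) :
    IsUpperSet (secL A y : Set (Finset γ₁)) := by
  intro x x' hxx' hx
  simp only [mem_coe, mem_secL] at hx ⊢
  exact hA (disjSum_mono hxx' le_rfl) hx

omit [DecidableEq β] [Fintype β] [Fintype γ₁] in
/-- Sections of an up-set are up-sets (right). [this work] -/
theorem isUpperSet_secR {A : Finset (Finset (γ₁ ⊕ γ₂))} (hA : IsUpperSet (A : Set (Finset (γ₁ ⊕ γ₂)))) (x : Finset γ₁) :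
    IsUpperSet (secR A x : Set (Finset γ₂)) := by
  intro y y' hyy' hy
  simp only [mem_coe, mem_secR] at hy ⊢
  exact hA (disjSum_mono le_rfl hyy') hy

/-- The product region `Z₁ × Z₂ = {t | t.toLeft ∈ Z₁ ∧ t.toRight ∈ Z₂}`. [this work] -/
def zProd (Z₁ : Finset (Finset γ₁)) (Z₂ : Finset (Finset γ₂)) : Finset (Finset (γ₁ ⊕ γ₂)) :=
  univ.filter fun t => t.toLeft ∈ Z₁ ∧ t.toRight ∈ Z₂

omit [DecidableEq β] [Fintype β] in
/-- Membership in the product region. [this work] -/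
@[simp] theorem mem_zProd {Z₁ : Finset (Finset γ₁)} {Z₂ : Finset (Finset γ₂)} {t : Finset (γ₁ ⊕ γ₂)} :
    t ∈ zProd Z₁ Z₂ ↔ t.toLeft ∈ Z₁ ∧ t.toRight ∈ Z₂ := by
  simp [zProd]

/-! ### The fibre identity -/

omit [DecidableEq β] [Fintype β] in
/-- The Kleitman sum as a sum of indicators. [this work] -/
theorem klL_eq_sum_ind {δ : Type} [DecidableEq δ] [Fintype δ] (T A B : Finset (Finset δ)) :
    klL T A B = ∑ t ∈ T, (ind A t - ind (refl A) t) * ind B t := by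
  unfold klL
  have h1 : ((T ∩ A ∩ B).card : ℤ) = ∑ t ∈ T, ind A t * ind B t := by
    rw [show T ∩ A ∩ B = (A ∩ B) ∩ T by ext s; simp only [mem_inter]; tauto, card_inter_eq_sum_ind]
    refine sum_congr rfl fun t _ => ?_
    unfold ind; by_cases ha : t ∈ A <;> by_cases hb : t ∈ B <;> simp [ha, hb, mem_inter]
  have h2 : ((T ∩ refl A ∩ B).card : ℤ) = ∑ t ∈ T, ind (refl A) t * ind B t := by
    rw [show T ∩ refl A ∩ B = (refl A ∩ B) ∩ T by ext s; simp only [mem_inter]; tauto, card_inter_eq_sum_ind]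
    refine sum_congr rfl fun t _ => ?_
    unfold ind; by_cases ha : t ∈ refl A <;> by_cases hb : t ∈ B <;> simp [ha, hb, mem_inter]
  rw [h1, h2, ← sum_sub_distrib]
  refine sum_congr rfl fun t _ => ?_
  ring

omit [DecidableEq β] [Fintype β] in
/-- A sum over a region of the product cube as a double sum over the two blocks. [this work] -/
theorem sum_zProd_eq (Z₁ : Finset (Finset γ₁)) (Z₂ : Finset (Finset γ₂)) (f : Finset (γ₁ ⊕ γ₂) → ℤ) :
    ∑ t ∈ zProd Z₁ Z₂, f t = ∑ x ∈ Z₁, ∑ y ∈ Z₂, f (x.disjSum y) := by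
  rw [← Finset.sum_product' Z₁ Z₂ (fun x y => f (x.disjSum y))]
  refine Finset.sum_bij' (fun t _ => (t.toLeft, t.toRight)) (fun p _ => p.1.disjSum p.2) ?_ ?_ ?_ ?_ ?_
  · intro t ht; rw [mem_zProd] at ht; exact mem_product.2 ht
  · intro p hp; rw [mem_product] at hp; rw [mem_zProd, toLeft_disjSum, toRight_disjSum]; exact hp
  · intro t _; exact toLeft_disjSum_toRight
  · intro p _; simp
  · intro t _; simp [toLeft_disjSum_toRight]

omit [DecidableEq β] [Fintype β] in
/-- Indicators along sections: `[x ⊔ y ∈ A] = [x ∈ A^y] = [y ∈ A_x]` and the reflected versions. [this work] -/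
theorem ind_disjSum_eq (A : Finset (Finset (γ₁ ⊕ γ₂))) (x : Finset γ₁) (y : Finset γ₂) :
    ind A (x.disjSum y) = ind (secL A y) x ∧ ind A (x.disjSum y) = ind (secR A x) y ∧
    ind (refl A) (x.disjSum y) = ind (refl (secR A xᶜ)) y ∧ ind A (xᶜ.disjSum y) = ind (refl (secL A y)) x ∧
    ind A (xᶜ.disjSum y) = ind (secR A xᶜ) y := by
  unfold ind
  refine ⟨by simp, by simp, ?_, ?_, by simp⟩
  · simp only [mem_refl, mem_secR, compl_disjSum]
  · simp only [mem_refl, mem_secL]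

omit [DecidableEq β] [Fintype β] in
/-- **Fibre identity.**  `klL (Z₁ × Z₂) A B = Σ_{y∈Z₂} klL Z₁ (A^y) (B^y) + Σ_{x∈Z₁} klL Z₂ (A_{xᶜ}) (B_x)`. [this work] -/
theorem klL_zProd_eq (Z₁ : Finset (Finset γ₁)) (Z₂ : Finset (Finset γ₂)) (A B : Finset (Finset (γ₁ ⊕ γ₂))) :
    klL (zProd Z₁ Z₂) A B
      = ∑ y ∈ Z₂, klL Z₁ (secL A y) (secL B y) + ∑ x ∈ Z₁, klL Z₂ (secR A xᶜ) (secR B x) := by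
  rw [klL_eq_sum_ind, sum_zProd_eq]
  -- split the summand: `a(x,y) − a(xᶜ,yᶜ) = [a(x,y) − a(xᶜ,y)] + [a(xᶜ,y) − a(xᶜ,yᶜ)]`
  have hsplit : ∀ x : Finset γ₁, ∀ y : Finset γ₂,
      (ind A (x.disjSum y) - ind (refl A) (x.disjSum y)) * ind B (x.disjSum y)
        = (ind (secL A y) x - ind (refl (secL A y)) x) * ind (secL B y) x
          + (ind (secR A xᶜ) y - ind (refl (secR A xᶜ)) y) * ind (secR B x) y := by
    intro x y
    obtain ⟨h1, _, h3, h4, h5⟩ := ind_disjSum_eq A x y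
    obtain ⟨hb1, hb2, _, _, _⟩ := ind_disjSum_eq B x y
    rw [h1, h3, hb1, ← h4, h5, ← hb1, hb2]
    ring
  simp_rw [hsplit, sum_add_distrib]
  congr 1
  · rw [sum_comm]
    refine sum_congr rfl fun y _ => ?_
    rw [klL_eq_sum_ind]
  · refine sum_congr rfl fun x _ => ?_
    rw [klL_eq_sum_ind]

omit [DecidableEq β] [Fintype β] in
/-- The whole product cube is `univ × univ`. [this work] -/
theorem zProd_univ_univ : zProd (univ : Finset (Finset γ₁)) (univ : Finset (Finset γ₂)) = univ := by
  ext t; simp [zProd]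

/-! ### Products of Kleitman shells -/

omit [DecidableEq β] [Fintype β] in
/-- **Product of Kleitman shells.**  If `T₁` and `T₂` are Kleitman shells of their blocks, then `W ∖ (T₁ᶜ × T₂ᶜ)` is a Kleitman shell of the
product cube. [this work] -/
theorem klShell_prod {T₁ : Finset (Finset γ₁)} {T₂ : Finset (Finset γ₂)} (h₁ : KlShell T₁) (h₂ : KlShell T₂) :
    KlShell (univ \ zProd T₁ᶜ T₂ᶜ : Finset (Finset (γ₁ ⊕ γ₂))) := by
  intro A B hA hB
  rw [klL_sdiff (subset_univ _), ← zProd_univ_univ, klL_zProd_eq, klL_zProd_eq]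
  -- fibrewise: `klL Tᶜ U V = klL univ U V − klL T U V ≤ klL univ U V`, and the dropped fibres have `klL univ ≥ 0`
  have hsec1 : ∀ y : Finset γ₂, 0 ≤ klL univ (secL A y) (secL B y) := fun y =>
    klShell_univ _ _ (isUpperSet_secL hA y) (isUpperSet_secL hB y)
  have hsec2 : ∀ x : Finset γ₁, 0 ≤ klL univ (secR A xᶜ) (secR B x) := fun x =>
    klShell_univ _ _ (isUpperSet_secR hA xᶜ) (isUpperSet_secR hB x)
  have hle1 : ∀ y : Finset γ₂, klL T₁ᶜ (secL A y) (secL B y) ≤ klL univ (secL A y) (secL B y) := by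
    intro y
    rw [show T₁ᶜ = univ \ T₁ from compl_eq_univ_sdiff T₁, klL_sdiff (subset_univ _)]
    linarith [h₁ _ _ (isUpperSet_secL hA y) (isUpperSet_secL hB y)]
  have hle2 : ∀ x : Finset γ₁, klL T₂ᶜ (secR A xᶜ) (secR B x) ≤ klL univ (secR A xᶜ) (secR B x) := by
    intro x
    rw [show T₂ᶜ = univ \ T₂ from compl_eq_univ_sdiff T₂, klL_sdiff (subset_univ _)]
    linarith [h₂ _ _ (isUpperSet_secR hA xᶜ) (isUpperSet_secR hB x)]
  have s1 : ∑ y ∈ T₂ᶜ, klL T₁ᶜ (secL A y) (secL B y) ≤ ∑ y ∈ (univ : Finset (Finset γ₂)), klL univ (secL A y) (secL B y) :=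
    (sum_le_sum fun y _ => hle1 y).trans (sum_le_sum_of_subset_of_nonneg (subset_univ _) fun y _ _ => hsec1 y)
  have s2 : ∑ x ∈ T₁ᶜ, klL T₂ᶜ (secR A xᶜ) (secR B x) ≤ ∑ x ∈ (univ : Finset (Finset γ₁)), klL univ (secR A xᶜ) (secR B x) :=
    (sum_le_sum fun x _ => hle2 x).trans (sum_le_sum_of_subset_of_nonneg (subset_univ _) fun x _ _ => hsec2 x)
  linarith

/-! ### OR-products of families -/

/-- The **OR-product** of two families over disjoint blocks: `{t | t.toLeft ∈ P₁ ∨ t.toRight ∈ P₂}`. [this work] -/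
def orProd (P₁ : Finset (Finset γ₁)) (P₂ : Finset (Finset γ₂)) : Finset (Finset (γ₁ ⊕ γ₂)) :=
  univ.filter fun t => t.toLeft ∈ P₁ ∨ t.toRight ∈ P₂

omit [DecidableEq β] [Fintype β] in
/-- Membership in the OR-product. [this work] -/
@[simp] theorem mem_orProd {P₁ : Finset (Finset γ₁)} {P₂ : Finset (Finset γ₂)} {t : Finset (γ₁ ⊕ γ₂)} :
    t ∈ orProd P₁ P₂ ↔ t.toLeft ∈ P₁ ∨ t.toRight ∈ P₂ := by
  simp [orProd]

omit [DecidableEq β] [Fintype β] in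
/-- The OR-product of up-sets is an up-set. [this work] -/
theorem isUpperSet_orProd {P₁ : Finset (Finset γ₁)} {P₂ : Finset (Finset γ₂)} (h₁ : IsUpperSet (P₁ : Set (Finset γ₁)))
    (h₂ : IsUpperSet (P₂ : Set (Finset γ₂))) : IsUpperSet (orProd P₁ P₂ : Set (Finset (γ₁ ⊕ γ₂))) := by
  intro t t' htt' ht
  simp only [mem_coe, mem_orProd] at ht ⊢
  rcases ht with h | h
  · exact Or.inl (h₁ (toLeft_subset_toLeft htt') h)
  · exact Or.inr (h₂ (toRight_subset_toRight htt') h)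

omit [DecidableEq β] [Fintype β] in
/-- **The shell of an OR-product**: `orProd P₁ P₂ ∪ refl (orProd P₁ P₂) = W ∖ ((P₁ ∪ refl P₁)ᶜ × (P₂ ∪ refl P₂)ᶜ)`. [this work] -/
theorem orProd_union_refl (P₁ : Finset (Finset γ₁)) (P₂ : Finset (Finset γ₂)) :
    orProd P₁ P₂ ∪ refl (orProd P₁ P₂) = univ \ zProd (P₁ ∪ refl P₁)ᶜ (P₂ ∪ refl P₂)ᶜ := by
  ext t
  simp only [mem_union, mem_orProd, mem_refl, mem_sdiff, mem_univ, true_and, mem_zProd, mem_compl, toLeft_compl, toRight_compl]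
  tauto

omit [DecidableEq β] [Fintype β] in
/-- **OR-products of shell families are shell families.** [this work] -/
theorem klShell_orProd {P₁ : Finset (Finset γ₁)} {P₂ : Finset (Finset γ₂)} (h₁ : KlShell (P₁ ∪ refl P₁)) (h₂ : KlShell (P₂ ∪ refl P₂)) :
    KlShell (orProd P₁ P₂ ∪ refl (orProd P₁ P₂)) := by
  rw [orProd_union_refl]
  exact klShell_prod h₁ h₂

/-- **`TriWIneq` for OR-products of shell families**: if the up-sets `P₁ ⊆ Finset γ₁`, `P₂ ⊆ Finset γ₂` have Kleitman shells, then
`0 ≤ triW (orProd P₁ P₂) F G` for EVERY index cube `Finset β` and all monotone families `F, G` of up-sets of `Finset (γ₁ ⊕ γ₂)` (Formula A certificate). [this work] -/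
theorem triW_nonneg_orProd {P₁ : Finset (Finset γ₁)} {P₂ : Finset (Finset γ₂)}
    (hP₁ : IsUpperSet (P₁ : Set (Finset γ₁))) (hP₂ : IsUpperSet (P₂ : Set (Finset γ₂)))
    (h₁ : KlShell (P₁ ∪ refl P₁)) (h₂ : KlShell (P₂ ∪ refl P₂))
    (F G : Finset β → Finset (Finset (γ₁ ⊕ γ₂)))
    (hF : ∀ x, IsUpperSet (F x : Set (Finset (γ₁ ⊕ γ₂)))) (hG : ∀ x, IsUpperSet (G x : Set (Finset (γ₁ ⊕ γ₂))))
    (hFm : Monotone F) (hGm : Monotone G) :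
    0 ≤ triW (orProd P₁ P₂) F G :=
  triW_nonneg_of_shell (isUpperSet_orProd hP₁ hP₂) (klShell_orProd h₁ h₂) F G hF hG hFm hGm

end FiveUpSet

end Summit.CriticalPhenomena.PercolationContinuityZ3.Theorems
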